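import Literature.MathematicalPhysics.QuantumFieldTheory.Federbush1986.Regime2CombLargeN
import Literature.MathematicalPhysics.QuantumFieldTheory.Federbush1986.Regime2CombSU2
import Literature.MathematicalPhysics.QuantumFieldTheory.Federbush1986.PureAveragesUNLemma11
import Literature.MathematicalPhysics.QuantumFieldTheory.Federbush1986.PureAveragesUNLemma13Converse
import Literature.MathematicalPhysics.QuantumFieldTheory.Federbush1986.PureAveragesSUN
import Literature.MathematicalPhysics.QuantumFieldTheory.Federbush1986.PureAveragesClosedSubgroup

/-!
# `Federbush1986.LocalStabilityThm42ModelInstances` — [Federbush1987PhaseCellIII] Local Stability Theorem 4.2 (4.4) p. 299,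
# «for suitable fixed N, c_d», for the tree's four-dimensional COMB Regime-2 scheme AT THE MODEL INSTANCES
# `G = U(N)`, `G = SU(N)`, `G = SU(2)` (unit quaternions) and `G = H`, every closed (locally exponential) `H ≤ U(N)` —
# the §1 hypotheses (Lemma 1.1, Lemma 1.3) of p32's `exists_cd_N₀_localStabilityTheorem42_of_lemmas` DISCHARGED

statement-level skeleton of published theorems with citation tags; proofs where landed; nothing here is a claim about the Yang–Mills mass gap

CITATION HEADER.  P. Federbush, *A phase cell approach to Yang–Mills theory. III. Local stability, modified renormalization group
transformation*, Commun. Math. Phys. **110** (1987) 293–309 [Federbush1987PhaseCellIII]: p. 294 «Let G be a compact Lie Group,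
and d( , ) an invariant distance defined on G»; p. 299 «LOCAL STABILITY THEOREM 4.2. There is a number f₁ > 0 such that in
Regime 2, Δ̃S(P) ≥ f₁a². (4.4)» … «All these results will hold for suitable fixed N, c_d, f₁, f₂, and a₀, where a must satisfy
a < a₀.»; p. 295 Lemma 1.1 (1.4)–(1.5), (1.11), Lemma 1.3 (1.12).  lit-balaban cell (HOME `run/shared/lean/pub/lit-balaban/`), unit
`lit-balaban-r17` gen 14 (reader/typer r17 = fold owner of the Federbush rows and row owner of F3.Thm4.2; free-target protocol
G.5-34(d), TAKING line 2026-08-22T17:34:13Z, p32 unseated and notified), SKELETON row **F3.Thm4.2** (also F3.Lem1.1, F3.Lem1.3) of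
`HOME/lit-balaban-r17/SKELETON-r17.md`.  **v1.1 (gen 15, referee note ref-5 g56 N-g56-1):** v1.0's §2 declared
`LocalStabilityG.exists_cd_N₀_localStabilityTheorem42_SU2` (with a `[CompactSpace SU2]` binder) under the SAME fully qualified
name as p32 gen 14's `Regime2CombSU2.lean` (p335963, landed first, binder-free via the local instance `SU2.compactSpace`), so no
module could import both; v1.1 RETIRES this file's copy and IMPORTS `Regime2CombSU2` instead — the `G = SU(2)` instance is p32's
theorem of that name, re-exported here by the import; §1, §3–§5 are byte-unchanged.  Inputs BY NAME, none edited: p32 gen 14's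
`Regime2CombLargeN` (**`LocalStabilityG.exists_cd_N₀_localStabilityTheorem42_of_lemmas (h11 : Lemma11 L.exp) (h13 : Lemma13 L.exp)`**,
p334043, on the capstone `Regime2CombCapstone.localStabilityTheorem42_familyC` p333510 and the comb chain `Regime2CombScheme.familyC`
… `Regime2CombDatum`) and `Regime2CombSU2` (**`LocalStabilityG.exists_cd_N₀_localStabilityTheorem42_SU2`**, p335963: `G = SU(2)`,
Lemma 1.1 = `SU2.lemma11_SU2`, Lemma 1.3 = `SU2.lemma13_SU2` at `SU2.localLog`, compactness `SU2.compactSpace`); the model-instance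
§1 lemmas: p12's `UN.lemma11_UN` (`PureAveragesUNLemma11`) and `UN.lemma13_UN` (`PureAveragesUNLemma13Converse`) at the chart
`UN.localLog` (`LocalLogChart`); this unit's gen-8 `UNLieSubgroup.lemma11H` / `lemma13H` / `UNLieSubgroup.localLog` /
`UNLieSubgroup.ofClosed` (`PureAveragesClosedSubgroup`, `NonAbelianDualityClosedSubgroup`) and `SUNSubgroup`
(`NonAbelianDualitySUN`); p32's carrier `SUN` (`PureAveragesSUN`).  Pattern: `LocalStabilityUN.lean` / `LocalStabilitySUN.lean` /
`PureAveragesClosedSubgroup` §4–§5 (the same discharge for (5.25) and Theorem 4.3 via Lemma 1.2).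

WHAT IS PROVED.  For each model instance, print's quantifier form of Theorem 4.2 for the comb scheme with NO §1 hypothesis left:
for every l.f.-plaquette budget `r₁` and hit constant `h > 0` there are `c_d > 0` and `N₀` such that for all block sides `N ≥ N₀`
and every l.f. action `A_lf ≥ 0` obeying the hit bound `h·a² ≤ A_lf(U)` (when some plaquette of `U` is l.f. and `A_lf(U) < 3a²`) and
the count bound `#l.f. ≤ r₁` (when `A_lf(U) < 3a²`), the family `familyC 2 N hN r₁ c_d A_lf` satisfies
`TwoLevelScheme.LocalStabilityTheorem42` («∃ f₁ > 0, ∃ a₀ > 0, ∀ a < a₀, Regime 2 ⇒ Δ̃S(P) ≥ f₁a²»):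
**`LocalStabilityG.exists_cd_N₀_localStabilityTheorem42_UN`** (`G = U(N)`, every `N`), **`…_SUN`** (`G = SU(N)`, every `N`),
**`…_H`** (`G = H` for every `UNLieSubgroup` datum, i.e. every closed locally exponential `H ≤ U(N)` with its Lie algebra `𝔥`),
**`…_closed`** (`G = H` for ANY closed subgroup `H ≤ U(N)`, chart `UNLieSubgroup.ofClosed`, Cartan–von Neumann); the instance
`G = SU(2)` (unit quaternions) is p32's **`…_SU2`** of `Regime2CombSU2`, imported (v1.1).

HONEST SCOPE.  (a) These are one-line specialisations; all the mathematics is p32's comb chain and the cited §1 lemmas.  (b) What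
remains hypothetical is exactly what is hypothetical in `exists_cd_N₀_localStabilityTheorem42_of_lemmas`: the two bookkeeping
properties of the abstract l.f. action `A_lf` (print defines `A_{l.f.}(p)` on p. 298 as «½a² of each l.f. plaquette distributed
equally among the plaquettes it hits»; the tree's schemes carry `A_lf` as a parameter), print's dimension four (`d + 2 = 4`), and
the tree's RENDERING of Regime 2 by COMB contours about a free-level base point in place of print's radial trees (HOME/GAPS.md
G-F3-p32-08).  (c) Row F3.Thm4.2 keeps its `typed` head (block rule G.1 / L-g2-1: model instances and the comb rendering).  (d) For
`SU(N)` the comb chain's inner-product requirement on the Lie algebra is met by the gen-8 datum `SUNSubgroup` (`𝔥 = 𝔰𝔲(N)` as a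
submodule of `𝔲(N)`); the statement is on p32's carrier `SUN n`, the same subtype `{det = 1}` of `U(N)` definitionally (p32's own
`SUN.lemma11_SUN` / `lemma13_SUN` at `SUN.localLog` would serve equally but `𝔰𝔲(N)` there carries no inner-product instance).
No definitions, no new named facts, no `sorry`; axioms standard.
-/

namespace Literature.MathematicalPhysics.QuantumFieldTheory.Federbush1986

namespace LocalStabilityG

open scoped BigOperators

/-! ## §1 `G = U(N)` -/

/-- **Local Stability Theorem 4.2 («for suitable fixed N, c_d») for the comb scheme, model instance `G = U(N)`, every `N`, NO §1
hypothesis**: Lemma 1.1 = `UN.lemma11_UN`, Lemma 1.3 = `UN.lemma13_UN` at the chart `UN.localLog`.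
[cite: Federbush1987PhaseCellIII, Local Stability Theorem 4.2 (4.4) p. 299; §4 p. 298–299 «for suitable fixed N, c_d»; Lemmas 1.1,
1.3 p. 295; §5.3 10) p. 305] -/
theorem exists_cd_N₀_localStabilityTheorem42_UN {n : ℕ} (r₁ : ℕ) {h : ℝ} (hh : 0 < h) :
    ∃ cd : ℝ, 0 < cd ∧ ∃ N₀ : ℕ, ∀ (N : ℕ) (hN : 0 < N), N₀ ≤ N →
      ∀ (Alf : ℝ → Cfg (UN n) 2 N → ℝ) (hAlf : ∀ a U, 0 ≤ Alf a U),
        (∀ a : ℝ, 0 < a → ∀ U : Cfg (UN n) 2 N, (∃ j, a ≤ dist 1 (plaqHol 2 N hN U j)) → Alf a U < 3 * a ^ 2 →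
          h * a ^ 2 ≤ Alf a U) →
        (∀ a : ℝ, 0 < a → ∀ U : Cfg (UN n) 2 N, Alf a U < 3 * a ^ 2 → (lfSet 2 N hN a U).card ≤ r₁) →
        TwoLevelScheme.LocalStabilityTheorem42 (familyC 2 N hN r₁ cd Alf hAlf) :=
  exists_cd_N₀_localStabilityTheorem42_of_lemmas UN.localLog UN.lemma11_UN UN.lemma13_UN r₁ hh

/-! ## §2 `G = SU(2)` (unit quaternions)

The model instance `G = SU(2)` (great-circle distance; Lemma 1.1 = `SU2.lemma11_SU2`, Lemma 1.3 = `SU2.lemma13_SU2` at the chart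
`SU2.localLog`, compactness `SU2.compactSpace` as a local instance) is p32 gen 14's theorem
`LocalStabilityG.exists_cd_N₀_localStabilityTheorem42_SU2` of `Regime2CombSU2` (p335963), available here through the import.
v1.0 of this file carried its own copy under the same fully qualified name (with a `[CompactSpace SU2]` binder); v1.1 retires it
(referee note ref-5 g56 N-g56-1: the two modules could not be imported together).
[cite: Federbush1987PhaseCellIII, Local Stability Theorem 4.2 (4.4) p. 299; §4 p. 298–299; Lemmas 1.1, 1.3 p. 295; §5.3 10) p. 305] -/

/-! ## §3 `G = H`, every closed locally exponential `H ≤ U(N)` (`UNLieSubgroup`) -/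

/-- **Local Stability Theorem 4.2 («for suitable fixed N, c_d») for the comb scheme, model instance `G = H` for every
`UNLieSubgroup` datum `D` (a closed `H ≤ U(N)` with Lie algebra `𝔥 ⊆ 𝔲(N)`, `e^{𝔥} ⊆ H`, locally onto), NO §1 hypothesis**:
Lemma 1.1 = `D.lemma11H`, Lemma 1.3 = `D.lemma13H` at the chart `D.localLog`.
[cite: Federbush1987PhaseCellIII, Local Stability Theorem 4.2 (4.4) p. 299; p. 294 «G a compact Lie Group … invariant distance»;
Lemmas 1.1, 1.3 p. 295; §5.3 10) p. 305] -/
theorem exists_cd_N₀_localStabilityTheorem42_H {n : ℕ} (D : UNLieSubgroup n) (r₁ : ℕ) {h : ℝ} (hh : 0 < h) :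
    ∃ cd : ℝ, 0 < cd ∧ ∃ N₀ : ℕ, ∀ (N : ℕ) (hN : 0 < N), N₀ ≤ N →
      ∀ (Alf : ℝ → Cfg D.H 2 N → ℝ) (hAlf : ∀ a U, 0 ≤ Alf a U),
        (∀ a : ℝ, 0 < a → ∀ U : Cfg D.H 2 N, (∃ j, a ≤ dist 1 (plaqHol 2 N hN U j)) → Alf a U < 3 * a ^ 2 →
          h * a ^ 2 ≤ Alf a U) →
        (∀ a : ℝ, 0 < a → ∀ U : Cfg D.H 2 N, Alf a U < 3 * a ^ 2 → (lfSet 2 N hN a U).card ≤ r₁) →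
        TwoLevelScheme.LocalStabilityTheorem42 (familyC 2 N hN r₁ cd Alf hAlf) :=
  exists_cd_N₀_localStabilityTheorem42_of_lemmas D.localLog D.lemma11H D.lemma13H r₁ hh

/-! ## §4 `G = SU(N)` -/

/-- **Local Stability Theorem 4.2 («for suitable fixed N, c_d») for the comb scheme, model instance `G = SU(N)`, every `N`, NO §1
hypothesis** — on p32's carrier `SUN n` (`PureAveragesSUN`): the §3 theorem at this unit's gen-8 datum `SUNSubgroup n`
(`H = {g ∈ U(N) : det g = 1}`, `𝔥 = 𝔰𝔲(N)` the traceless `𝔲(N)` with the restricted Frobenius inner product; Lemma 1.1 / 1.3 =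
`UNLieSubgroup.lemma11H` / `lemma13H`); the two presentations of `SU(N)` are the same subtype of `U(N)` definitionally.
[cite: Federbush1987PhaseCellIII, Local Stability Theorem 4.2 (4.4) p. 299; §4 p. 298–299; Lemmas 1.1, 1.3 p. 295; §5.3 10) p. 305;
Federbush1987PhaseCellVI, p. 17–19 «compact simple Lie group»] -/
theorem exists_cd_N₀_localStabilityTheorem42_SUN {n : ℕ} (r₁ : ℕ) {h : ℝ} (hh : 0 < h) :
    ∃ cd : ℝ, 0 < cd ∧ ∃ N₀ : ℕ, ∀ (N : ℕ) (hN : 0 < N), N₀ ≤ N →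
      ∀ (Alf : ℝ → Cfg (SUN n) 2 N → ℝ) (hAlf : ∀ a U, 0 ≤ Alf a U),
        (∀ a : ℝ, 0 < a → ∀ U : Cfg (SUN n) 2 N, (∃ j, a ≤ dist 1 (plaqHol 2 N hN U j)) → Alf a U < 3 * a ^ 2 →
          h * a ^ 2 ≤ Alf a U) →
        (∀ a : ℝ, 0 < a → ∀ U : Cfg (SUN n) 2 N, Alf a U < 3 * a ^ 2 → (lfSet 2 N hN a U).card ≤ r₁) →
        TwoLevelScheme.LocalStabilityTheorem42 (familyC 2 N hN r₁ cd Alf hAlf) :=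
  exists_cd_N₀_localStabilityTheorem42_H (SUNSubgroup n) r₁ hh

/-! ## §5 `G = H`, ANY closed subgroup `H ≤ U(N)` (Cartan–von Neumann datum `UNLieSubgroup.ofClosed`) -/

/-- **Local Stability Theorem 4.2 («for suitable fixed N, c_d») for the comb scheme, model instance `G = H`, `H` ANY closed
subgroup of `U(N)`** (as the type `↥H`, with the chart `UNLieSubgroup.ofClosed H hH`), NO §1 hypothesis.
[cite: Federbush1987PhaseCellIII, Local Stability Theorem 4.2 (4.4) p. 299; p. 294 «G a compact Lie Group»; §5.3 10) p. 305] -/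
theorem exists_cd_N₀_localStabilityTheorem42_closed {n : ℕ} (H : Subgroup (UN n)) (hH : IsClosed (H : Set (UN n))) (r₁ : ℕ)
    {h : ℝ} (hh : 0 < h) :
    ∃ cd : ℝ, 0 < cd ∧ ∃ N₀ : ℕ, ∀ (N : ℕ) (hN : 0 < N), N₀ ≤ N →
      ∀ (Alf : ℝ → Cfg (UNLieSubgroup.ofClosed H hH).H 2 N → ℝ) (hAlf : ∀ a U, 0 ≤ Alf a U),
        (∀ a : ℝ, 0 < a → ∀ U : Cfg (UNLieSubgroup.ofClosed H hH).H 2 N, (∃ j, a ≤ dist 1 (plaqHol 2 N hN U j)) →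
          Alf a U < 3 * a ^ 2 → h * a ^ 2 ≤ Alf a U) →
        (∀ a : ℝ, 0 < a → ∀ U : Cfg (UNLieSubgroup.ofClosed H hH).H 2 N, Alf a U < 3 * a ^ 2 →
          (lfSet 2 N hN a U).card ≤ r₁) →
        TwoLevelScheme.LocalStabilityTheorem42 (familyC 2 N hN r₁ cd Alf hAlf) :=
  exists_cd_N₀_localStabilityTheorem42_H (UNLieSubgroup.ofClosed H hH) r₁ hh

end LocalStabilityG

end Literature.MathematicalPhysics.QuantumFieldTheory.Federbush1986
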